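import Mathlib
import Summits.ValiantsHypothesis.ValiantsHypothesis.Theorems.LacunarySymmetroidMatrixDescartesOneAlternation
import Summits.ValiantsHypothesis.ValiantsHypothesis.Theorems.LacunarySymmetroidMatrixDescartesInertiaGlobalIndex
import Summits.ValiantsHypothesis.ValiantsHypothesis.Theorems.LacunarySymmetroidMatrixDescartesInertiaDerivativeWindows

/-!
# `MatrixDescartes` (stmt-ValiantsHypothesis-18050) — INERTIA KIT, IV-g: ONE-ALTERNATION WORDS ARE EXACT —
# every positive root of a `(+ … +)(J)(− … −)` word is of NEGATIVE TYPE, so `Z₊ + ν(S_bottom) = ν(S_top)` with multiplicity;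
# two-sided definite ends ⇒ EXACTLY `m` positive roots; the first rung `X^e J + NSD letters` ⇒ EXACTLY `π(J)`

HONEST FRAMING.  Cell `pub-symmetroid`, seat `val-sym-mdr-p2` (gen 18); helper file `--supports` the crux
`Theses.LacunarySymmetroid.MatrixDescartes`, NO closure claim.  It upgrades the tree's one-alternation INEQUALITY
`Z₊ ≤ card ι` (`oneAlternation`, `…OneAlternation.lean`; Cameron–Psarrakos Lemma 6 for definite-or-null letters) to an
IDENTITY counted with multiplicity, by feeding the tree's EXACT ONE-TYPE COUNT (`Inertia.card_posRoots_multiset_eq_of_negType`,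
`…InertiaGlobalIndex.lean`) with the observation that on a one-alternation word every positive root is of negative type.
Nothing here bears on the crux in its window, on `stub_twoSided`, on `DoorA26`/`DoorA34`, registers, or `VP ≠ VNP`.

SETTING.  `F(X) = ∑ₖ X^{dₖ} Sₖ`, real symmetric `ι × ι` letters over any finite letter type, a pivot exponent `e`:
`Sₖ ⪰ 0` for `dₖ < e`, `Sₖ ⪯ 0` for `dₖ > e`, letters AT the pivot exponent arbitrary symmetric (the word `(+…+)(J)(−…−)`).

RESULTS (namespace `Inertia`).
* `oneAlternation_negType` — THE TYPE LEMMA: if `det F ≢ 0`, then at every positive root `t` and every kernel vector `u ≠ 0`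
  of `F(t)` the Rayleigh `K`-nomial `P_u = ∑ₖ (uᵀSₖu)X^{dₖ}` satisfies `P_u′(t) < 0`.  Proof: `t·P_u′(t) = t·P_u′(t) − e·P_u(t) =
  ∑ₖ (dₖ − e)(uᵀSₖu)t^{dₖ}` is a sum of non-positive terms; if it vanished, every non-pivot letter would kill `u`
  (`uᵀSₖu = 0 ⇒ Sₖu = 0` for semidefinite `Sₖ`), the kernel relation would kill the pivot block, and `F(x)u = 0` for all
  `x`, i.e. `det F ≡ 0`.
* `oneAlternation_exact` — **THE ONE-ALTERNATION EXACT COUNT**: with unique extreme exponents `d_{l₀} < ⋯ < d_{l₁}` and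
  non-singular extreme letters, the positive roots of `det F` counted with multiplicity satisfy
  **`Z₊ + ν(S_{l₀}) = ν(S_{l₁})`** and **`Z₊ + π(S_{l₁}) = π(S_{l₀})`** (`ν`/`π` = number of negative/positive eigenvalues).
* `oneAlternation_exact_twoSided` — pivot strictly inside (`S_{l₀} ≻ 0`, `S_{l₁} ≺ 0`): **exactly `card ι`** positive roots
  with multiplicity (every eigenvalue crosses zero exactly once; the inequality `oneAlternation` is an equality with multiplicity).
* `firstRung_exact` — pivot at the bottom (`e = d_{l₀}`, `J = S_{l₀}` any non-singular symmetric letter, top letter `≺ 0`):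
  **exactly `π(J)`** positive roots with multiplicity — the exact form of the Lift line's first rung.
[folklore]; axioms `propext`, `Classical.choice`, `Quot.sound`; no definitions.
-/

-- layout Summits/ValiantsHypothesis/ValiantsHypothesis forces the duplicated namespace component
set_option linter.dupNamespace false

namespace Summit.ValiantsHypothesis.ValiantsHypothesis.Theorems.LacunarySymmetroidMatrixDescartes

open Matrix Finset Polynomial
open scoped BigOperators Topology

namespace Inertia

variable {ι : Type} [Fintype ι] [DecidableEq ι] {κ : Type} [Fintype κ]

/-- Value of the derivative of a Rayleigh `K`-nomial: `(∑ₖ C(aₖ) X^{dₖ})′(t) · t = ∑ₖ dₖ aₖ t^{dₖ}`. [folklore] -/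
theorem mul_eval_derivative_rayleigh (a : κ → ℝ) (d : κ → ℕ) (t : ℝ) :
    t * (derivative (∑ k, C (a k) * (X : ℝ[X]) ^ d k)).eval t = ∑ k, (d k : ℝ) * a k * t ^ d k := by
  rw [derivative_sum, eval_finsetSum, Finset.mul_sum]
  refine Finset.sum_congr rfl fun k _ => ?_
  rw [derivative_C_mul_X_pow, eval_mul, eval_C, eval_pow, eval_X]
  rcases Nat.eq_zero_or_pos (d k) with h0 | hpos
  · rw [h0]
    simp
  · have : t * t ^ (d k - 1) = t ^ d k := by
      rw [← pow_succ', Nat.sub_add_cancel hpos]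
    calc t * (a k * (d k : ℝ) * t ^ (d k - 1)) = (d k : ℝ) * a k * (t * t ^ (d k - 1)) := by ring
      _ = (d k : ℝ) * a k * t ^ d k := by rw [this]

/-- **THE TYPE LEMMA for one-alternation words.**  `Sₖ ⪰ 0` below the pivot exponent `e`, `Sₖ ⪯ 0` above it, letters at `e`
arbitrary symmetric, `det F ≢ 0`: at every positive root `t`, every kernel vector `u ≠ 0` of `F(t)` has `P_u′(t) < 0`
(negative type). [folklore] -/
theorem oneAlternation_negType (e : ℕ) (d : κ → ℕ) (S : κ → Matrix ι ι ℝ)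
    (hlo : ∀ k, d k < e → (S k).PosSemidef) (hhi : ∀ k, e < d k → (-S k).PosSemidef)
    (hdet : Matrix.det (∑ k, ((X : ℝ[X]) ^ d k) • (S k).map C) ≠ 0)
    (t : ℝ) (ht : 0 < t) (u : ι → ℝ) (hu : (∑ k, t ^ d k • S k) *ᵥ u = 0) (hu0 : u ≠ 0) :
    (derivative (∑ k, C (u ⬝ᵥ (S k *ᵥ u)) * (X : ℝ[X]) ^ d k)).eval t < 0 := by
  set a : κ → ℝ := fun k => u ⬝ᵥ (S k *ᵥ u) with ha
  set D := (derivative (∑ k, C (a k) * (X : ℝ[X]) ^ d k)).eval t with hD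
  -- the kernel relation `P_u(t) = 0`
  have hPu : ∑ k, t ^ d k * a k = 0 := by
    have h := OneAlternation.dotProduct_family_mulVec (fun k => t ^ d k) S u
    rw [hu, dotProduct_zero] at h
    exact h.symm
  -- `t · P_u′(t) = ∑ (dₖ − e) aₖ t^{dₖ}`
  have hkey : t * D = ∑ k, ((d k : ℝ) - e) * a k * t ^ d k := by
    rw [hD, mul_eval_derivative_rayleigh]
    have h0 : (e : ℝ) * ∑ k, t ^ d k * a k = 0 := by rw [hPu, mul_zero]
    calc ∑ k, (d k : ℝ) * a k * t ^ d k = ∑ k, (d k : ℝ) * a k * t ^ d k - (e : ℝ) * ∑ k, t ^ d k * a k := by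
          rw [h0, sub_zero]
      _ = ∑ k, ((d k : ℝ) - e) * a k * t ^ d k := by
          rw [Finset.mul_sum, ← Finset.sum_sub_distrib]
          refine Finset.sum_congr rfl fun k _ => ?_
          ring
  -- every term is non-positive
  have hterm : ∀ k, ((d k : ℝ) - e) * a k * t ^ d k ≤ 0 := by
    intro k
    have htk : 0 ≤ t ^ d k := pow_nonneg ht.le _
    rcases lt_trichotomy (d k) e with hlt | heq | hgt
    · have hq : 0 ≤ a k := by
        simpa only [ha, star_trivial] using (hlo k hlt).dotProduct_mulVec_nonneg u
      have hc : (d k : ℝ) - e ≤ 0 := by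
        have : (d k : ℝ) < e := by exact_mod_cast hlt
        linarith
      exact mul_nonpos_of_nonpos_of_nonneg (mul_nonpos_of_nonpos_of_nonneg hc hq) htk
    · rw [heq, sub_self, zero_mul, zero_mul]
    · have hq : a k ≤ 0 := by
        have h := (hhi k hgt).dotProduct_mulVec_nonneg u
        rw [star_trivial, Matrix.neg_mulVec, dotProduct_neg] at h
        simp only [ha]
        linarith
      have hc : 0 ≤ (d k : ℝ) - e := by
        have : (e : ℝ) < d k := by exact_mod_cast hgt
        linarith
      exact mul_nonpos_of_nonpos_of_nonneg (mul_nonpos_of_nonneg_of_nonpos hc hq) htk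
  have hle : t * D ≤ 0 := by rw [hkey]; exact Finset.sum_nonpos fun k _ => hterm k
  have hDle : D ≤ 0 := by
    by_contra h
    push Not at h
    have := mul_pos ht h
    linarith
  rcases lt_or_eq_of_le hDle with hlt | hDeq
  · exact hlt
  -- the degenerate case `P_u′(t) = 0` forces `det F ≡ 0`
  exfalso
  have hall : ∀ k, ((d k : ℝ) - e) * a k * t ^ d k = 0 := by
    have hs : ∑ k, ((d k : ℝ) - e) * a k * t ^ d k = 0 := by rw [← hkey, hDeq, mul_zero]
    intro k
    exact (Finset.sum_eq_zero_iff_of_nonpos fun k _ => hterm k).1 hs k (Finset.mem_univ k)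
  have hSu : ∀ k, d k ≠ e → S k *ᵥ u = 0 := by
    intro k hk
    have htk : t ^ d k ≠ 0 := pow_ne_zero _ ht.ne'
    have hak : a k = 0 := by
      have h := hall k
      have hce : ((d k : ℝ) - e) ≠ 0 := by
        intro h0
        apply hk
        have : (d k : ℝ) = e := by linarith
        exact_mod_cast this
      rcases mul_eq_zero.1 h with h1 | h1
      · rcases mul_eq_zero.1 h1 with h2 | h2
        · exact absurd h2 hce
        · exact h2
      · exact absurd h1 htk
    rcases lt_or_gt_of_ne hk with hlt | hgt
    · have h := (hlo k hlt).dotProduct_mulVec_zero_iff u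
      rw [star_trivial] at h
      exact h.1 hak
    · have h := (hhi k hgt).dotProduct_mulVec_zero_iff u
      rw [star_trivial, Matrix.neg_mulVec, dotProduct_neg, neg_eq_zero, neg_eq_zero] at h
      exact h.1 hak
  -- the pencil applied to `u` collapses to the pivot block
  have hFx : ∀ x : ℝ, (∑ k, x ^ d k • S k) *ᵥ u = x ^ e • ∑ k ∈ univ.filter (fun k => d k = e), S k *ᵥ u := by
    intro x
    rw [Matrix.sum_mulVec, Finset.smul_sum]
    rw [← Finset.sum_filter_add_sum_filter_not univ (fun k => d k = e)]
    have h2 : ∑ k ∈ univ.filter (fun k => ¬ d k = e), (x ^ d k • S k) *ᵥ u = 0 :=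
      Finset.sum_eq_zero fun k hk => by
        rw [Matrix.smul_mulVec, hSu k (Finset.mem_filter.1 hk).2, smul_zero]
    rw [h2, add_zero]
    refine Finset.sum_congr rfl fun k hk => ?_
    rw [Matrix.smul_mulVec, (Finset.mem_filter.1 hk).2]
  have hw : ∑ k ∈ univ.filter (fun k => d k = e), S k *ᵥ u = 0 := by
    have h := hFx t
    rw [hu] at h
    have hte : (t ^ e : ℝ) ≠ 0 := pow_ne_zero _ ht.ne'
    exact (smul_eq_zero.1 h.symm).resolve_left hte
  have hzero : ∀ x : ℝ, (∑ k, x ^ d k • S k) *ᵥ u = 0 := fun x => by rw [hFx x, hw, smul_zero]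
  apply hdet
  apply Polynomial.funext
  intro x
  rw [DefiniteMoments.eval_det_pencil, eval_zero]
  exact (Matrix.exists_mulVec_eq_zero_iff).1 ⟨u, hu0, hzero x⟩

/-- **THE ONE-ALTERNATION EXACT COUNT.**  `F(X) = ∑ₖ X^{dₖ}Sₖ` real symmetric, `Sₖ ⪰ 0` for `dₖ < e`, `Sₖ ⪯ 0` for `dₖ > e`
(letters at the pivot exponent `e` arbitrary), unique extreme exponents `d_{l₀}` (minimum) and `d_{l₁}` (maximum) with
`S_{l₀}`, `S_{l₁}` non-singular.  Then the positive roots of `det F` counted with multiplicity satisfy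
`Z₊ + ν(S_{l₀}) = ν(S_{l₁})` and `Z₊ + π(S_{l₁}) = π(S_{l₀})`. [folklore] -/
theorem oneAlternation_exact (e : ℕ) (d : κ → ℕ) (S : κ → Matrix ι ι ℝ) (hS : ∀ k, (S k).IsSymm)
    (hlo : ∀ k, d k < e → (S k).PosSemidef) (hhi : ∀ k, e < d k → (-S k).PosSemidef) (l₀ l₁ : κ)
    (hmin : ∀ l, l ≠ l₀ → d l₀ < d l) (hmax : ∀ l, l ≠ l₁ → d l < d l₁) (h₀ : (S l₀).det ≠ 0) (h₁ : (S l₁).det ≠ 0) :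
    Multiset.card ((Matrix.det (∑ k, ((X : ℝ[X]) ^ d k) • (S k).map C)).roots.filter (fun t => 0 < t))
        + Fintype.card {j // (isHermitian_of_isSymm (hS l₀)).eigenvalues j < 0}
      = Fintype.card {j // (isHermitian_of_isSymm (hS l₁)).eigenvalues j < 0} ∧
    Multiset.card ((Matrix.det (∑ k, ((X : ℝ[X]) ^ d k) • (S k).map C)).roots.filter (fun t => 0 < t))
        + Fintype.card {j // 0 < (isHermitian_of_isSymm (hS l₁)).eigenvalues j}
      = Fintype.card {j // 0 < (isHermitian_of_isSymm (hS l₀)).eigenvalues j} := by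
  classical
  -- `det F ≢ 0`: the top letter is non-singular, so `F(x)` is non-singular for large `x`
  obtain ⟨N, hN⟩ := Filter.eventually_atTop.1 (eventually_atTop_indices_eq d S hS l₁ hmax h₁)
  have hdet : Matrix.det (∑ k, ((X : ℝ[X]) ^ d k) • (S k).map C) ≠ 0 :=
    det_pencil_ne_zero_of_eval d S (hN N le_rfl).2.2
  exact card_posRoots_multiset_eq_of_negType d S hS l₀ l₁ hmin hmax h₀ h₁
    (fun t ht _ u hu hu0 => oneAlternation_negType e d S hlo hhi hdet t ht u hu hu0)

/-- **TWO-SIDED ONE-ALTERNATION WORDS HAVE EXACTLY `m` POSITIVE ROOTS (with multiplicity).**  In the setting of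
`oneAlternation_exact` with the pivot strictly inside, i.e. `S_{l₀} ≻ 0` and `S_{l₁} ≺ 0`: the positive roots of `det F`
counted with multiplicity number exactly `card ι` — the tree's inequality `oneAlternation` (`Z₊ ≤ card ι` for distinct roots)
is an identity with multiplicity: every eigenvalue crosses zero exactly once. [folklore] -/
theorem oneAlternation_exact_twoSided (e : ℕ) (d : κ → ℕ) (S : κ → Matrix ι ι ℝ) (hS : ∀ k, (S k).IsSymm)
    (hlo : ∀ k, d k < e → (S k).PosSemidef) (hhi : ∀ k, e < d k → (-S k).PosSemidef) (l₀ l₁ : κ)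
    (hmin : ∀ l, l ≠ l₀ → d l₀ < d l) (hmax : ∀ l, l ≠ l₁ → d l < d l₁) (hbot : (S l₀).PosDef) (htop : (-S l₁).PosDef) :
    Multiset.card ((Matrix.det (∑ k, ((X : ℝ[X]) ^ d k) • (S k).map C)).roots.filter (fun t => 0 < t))
      = Fintype.card ι := by
  classical
  have h₀ : (S l₀).det ≠ 0 := hbot.det_pos.ne'
  have h₁ : (S l₁).det ≠ 0 := by
    intro h
    have hd := htop.det_pos
    rw [Matrix.det_neg, h, mul_zero] at hd
    exact lt_irrefl _ hd
  obtain ⟨hν, -⟩ := oneAlternation_exact e d S hS hlo hhi l₀ l₁ hmin hmax h₀ h₁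
  -- `ν(S_{l₀}) = 0` for a positive definite letter
  have hν0 : Fintype.card {j // (isHermitian_of_isSymm (hS l₀)).eigenvalues j < 0} = 0 := by
    rw [Fintype.card_eq_zero_iff]
    refine ⟨fun j => ?_⟩
    have hp : 0 < (isHermitian_of_isSymm (hS l₀)).eigenvalues j.1 := hbot.eigenvalues_pos j.1
    exact absurd j.2 (not_lt.2 hp.le)
  -- `ν(S_{l₁}) = card ι` for a negative definite letter
  have hν1 : Fintype.card {j // (isHermitian_of_isSymm (hS l₁)).eigenvalues j < 0} = Fintype.card ι := by
    refine negIndex_eq_card_of_negDef (isHermitian_of_isSymm (hS l₁)) fun u hu => ?_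
    have h := htop.dotProduct_mulVec_pos hu
    rw [star_trivial, Matrix.neg_mulVec, dotProduct_neg] at h
    linarith
  rw [hν0, hν1, add_zero] at hν
  exact hν

/-- **THE FIRST RUNG IS EXACT.**  `F(X) = X^e J + (letters of larger exponent, all ⪯ 0)` with `J = S_{l₀}` ANY non-singular real
symmetric letter at the unique bottom exponent `e = d_{l₀}` and a non-singular top letter `S_{l₁} ⪯ 0`: the positive roots of
`det F` counted with multiplicity number exactly `π(J)`, the number of positive eigenvalues of the pivot. [folklore] -/
theorem firstRung_exact (d : κ → ℕ) (S : κ → Matrix ι ι ℝ) (hS : ∀ k, (S k).IsSymm) (l₀ l₁ : κ)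
    (hmin : ∀ l, l ≠ l₀ → d l₀ < d l) (hmax : ∀ l, l ≠ l₁ → d l < d l₁)
    (hhi : ∀ k, d l₀ < d k → (-S k).PosSemidef) (h₀ : (S l₀).det ≠ 0) (h₁ : (S l₁).det ≠ 0)
    (htop : (-S l₁).PosSemidef) :
    Multiset.card ((Matrix.det (∑ k, ((X : ℝ[X]) ^ d k) • (S k).map C)).roots.filter (fun t => 0 < t))
      = Fintype.card {j // 0 < (isHermitian_of_isSymm (hS l₀)).eigenvalues j} := by
  classical
  have hlo : ∀ k, d k < d l₀ → (S k).PosSemidef := by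
    intro k hk
    exfalso
    by_cases hk0 : k = l₀
    · subst hk0
      exact lt_irrefl _ hk
    · exact absurd (hmin k hk0) (not_lt.2 hk.le)
  obtain ⟨-, hπ⟩ := oneAlternation_exact (d l₀) d S hS hlo hhi l₀ l₁ hmin hmax h₀ h₁
  -- `π(S_{l₁}) = 0` for a negative semidefinite letter
  have hπ1 : Fintype.card {j // 0 < (isHermitian_of_isSymm (hS l₁)).eigenvalues j} = 0 := by
    rw [Fintype.card_eq_zero_iff]
    refine ⟨fun j₀ => ?_⟩
    have hA : (S l₁).IsHermitian := isHermitian_of_isSymm (hS l₁)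
    let c : {j // 0 < hA.eigenvalues j} → ℝ := fun j => if j = j₀ then 1 else 0
    have hc : c ≠ 0 := fun h => by
      have := congrFun h j₀
      simp [c] at this
    have hpos := pos_eigenFamily hA c hc
    have hnonpos : (∑ i, c i • (hA.eigenvectorBasis i.1).ofLp) ⬝ᵥ
        (S l₁ *ᵥ ∑ i, c i • (hA.eigenvectorBasis i.1).ofLp) ≤ 0 := by
      have h := htop.dotProduct_mulVec_nonneg (∑ i, c i • (hA.eigenvectorBasis i.1).ofLp)
      rw [star_trivial, Matrix.neg_mulVec, dotProduct_neg] at h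
      linarith
    linarith
  rw [hπ1, add_zero] at hπ
  exact hπ

end Inertia

end Summit.ValiantsHypothesis.ValiantsHypothesis.Theorems.LacunarySymmetroidMatrixDescartes
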